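import Literature.MathematicalPhysics.QuantumFieldTheory.Balaban1983to89.B9SectBCodedChainR3

/-!
# `Balaban1983to89.B9SectBCodedReadingsUParH` — T. Bałaban, *Propagators for lattice gauge theories in a background field*, Commun. Math. Phys. **99** (1985) 389–434
# [Balaban1985BackgroundPropagators], Thm 3.4 p. 400 with (3.21) p. 394 (the site block-averaging contours `Γ_{y,x}` of `Q′(U)`) and (3.40) p. 397 (the Hölder quotients
# with `U(Γ_{x,x′})`, «`Γ_{x,x′}` a shortest contour»): THE SITE-SECTOR CODED READING `KSCU` WITH ITS TWO PRINTED TRANSPORTER ROLES SEPARATED — `KSCUPar … parA parH`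
# (pub-ymgap N06 [B9]; node00-def-Y g32 RULING on this seat's ⚑ FLAG K1-PAR, I.19099 ∕ I.19112: «GO your `KSCUPar … parA parH`»; CASCADE-K step K1-0)

statement-level skeleton of published theorems with citation tags; proofs where landed; nothing here is a claim about the Yang–Mills mass gap

THE PRINT.  (3.21) p. 394: the covariant block averaging `(Q′(U)f)(y) = Σ_{x ∈ B(y)} L^{−jd} U(Γ_{y,x}) f(x)` along the averaging contours `Γ_{y,x}`; (3.40) p. 397: the covariant
Hölder quotient `|U(Γ_{x,x′})f(x′) − f(x)| ∕ |x − x′|^α` with «`Γ_{x,x′}` a shortest contour connecting `x` with `x′`»; Thm 3.4 p. 400 (the random-walk expansion of `G′(U)`,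
read in the norms (3.42)–(3.47) pp. 397–398).  Two contour families: the AVERAGING contours (inside `Q′`, `Δ′_a`, `G′ = (Δ′_a)⁻¹`) and the SHORTEST contours of the Hölder
readings.

WHY THIS FILE (pub-ymgap node N06 [B9], the knit re-pin of the certificate — director-ym №375, dag-n06-d g24's CASCADE-K).  The coded site-sector reading of record
`B9SectBCodedReadingsUR.KSCU P G x par C37 C38 := kernelFamilySU … (GpY x.toKIdx par) par` feeds ONE transporter `par` to BOTH roles: the first occurrence is (3.21)'s
(`G′ = GpY par`), the second is (3.40)'s (the transporter of `kernelFamilySU`'s Hölder readings `hLatS … par U`, `hqS (par U) …`).  At the record (`par := parSymY`,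
taxicab contours in coordinate order) the two coincide harmlessly.  In the knit re-pin the averaging transporter becomes dag-n06-l's `parKnitY` — and
`B9B8AveragingJunction.parKnitY U z z′ = 1` for two generic sites of a block (neither the other's corner; `parOfT`'s last branch), so the Hölder law
`B9SectBH1ProbesY.HolderLipY cLip (parKnitY U) U` displayed by the (3.43) step (`stepH1Pos_KSCU_on`'s `hLip`) would ask the PLAIN difference `‖Ψ z′ − Ψ z‖` to be
bounded by covariant differences — not a law of the class; print never asks it (its Hölder contours are the shortest ones).  THIS FILE separates the roles (definitions +
`rfl` ∕ `Iff.rfl` faces only):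
* ★★★ `KSCUPar P G x parA parH C37 C38 := kernelFamilySU … (GpY x.toKIdx parA) parH` — averaging transporter `parA` (in `G′`), Hölder transporter `parH`;
  ★ `KSCU_eq_KSCUPar` (today's reading IS the diagonal instance `parA = parH = par`, `rfl`); `KSCUPar_h1_inl` (the (3.43) member reads
  `h1ReadT (G′_{parA}(dec c)) (parH (base c)) (base c)`, `rfl`).
* ★★★ `SectBStepUPar` ∕ ★★ `Thm34UPar P f dC c35 G b parA parH OA parB C37 C38 [Cinv]` — the row-13 targets with `KSCUPar` and the coded analyticity predicate
  `IsAnKY … (parA j)` (def-Y's ruling: the complex-letter ∕ analyticity clauses ride the AVERAGING family); ★ `sectBStepU_iff_par` ∕ `thm34U_iff_par` (today's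
  targets ARE the diagonal instances, `Iff.rfl`).
The knit instance is `(parA, parH) := (parKnitY, parSymY)`: (3.115) ∕ `hZ`, `Q′`, `R`, `Γ` on `parA` (dag-n06-l's `…_parKnitY` theorems), the Hölder readings on print's
shortest contours `parH = parSymY` (`hLip_parSymY`, `parSymY_mem`, `parSymY_inv_symm` in the tree).  CONSUMERS: node00-def-Y's `carriersYUParH … parA parH OA`
(`Gp := KSCUPar … (parA j) (parH j)`), dag-n06-d's leaf `b9LeafX_carriersYUPar` edition 2 (`hB : Thm32Printed … → Thm33Printed … (kernelFamilyS … (GpY (parA j)) (parH j)) →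
SectBStepUPar P f (d+1) c35Y G b parA parH OA …`), and the n06-c lineage's K1 (re-thread of `sectBStepU_of_members_g → … → sectBStepU_C37GY_su_extraYPb_closed` at
`(parA, parH)`).

HONEST SCOPE ∕ NOT CLAIMED.  Definitions and `rfl` ∕ `Iff.rfl` faces; NO step of Sect. B is re-proved here (K1 proper — the eight `KSCUPar` steps at `parA ≠ parH` — is
OPEN: the generic steps `stepKerPos_KSCU_on` ∕ `stepH1Pos_KSCU_on` … are typed over the single-`par` families `KSC₃ ∕ KSC₅ ∕ KSCU` and must be re-threaded); nothing of
[B9] asserted; count-neutral; N06 NOT discharged; nothing continuum ∕ OS ∕ mass gap ∕ Clay.  NEW file (definition lane: 4 `def`); no `sorry`, no `axiom`, no `instance`,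
no `notation`.  Cell `pub-ymgap` (D-0062), seat `pub-ymgap-dag-n06-c` (gen 23), 2026-08-30; `--supports stmt-QuantumFields-27364`.  Net new unproved facts: 0.

RELATED IN THE TREE, NOT DUPLICATED (searched 2026-08-30: `rg` for the basename and `KSCUPar` ∕ `SectBStepUPar` ∕ `Thm34UPar` over `lean/Literature` + `lean/Summits` — 0
hits): `B9SectBCodedChainR3` §`B9SectBCodedReadingsUR` (`KSCU`, `KACU`, `SectBStepU`, `Thm34U` — the diagonal instances; USED), `Node00/OpsYULetters.kernelFamilySU` (the
two-slot reader underneath, `O` and `par` already separate), `B9B8AveragingJunction.parKnitY`, `Node00.parSymY`, `B9Eq340HolderLipParSymY.hLip_parSymY`.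
-/

noncomputable section

namespace Literature.MathematicalPhysics.QuantumFieldTheory.Balaban1983to89.B9SectBCodedReadingsUParH

open Literature.MathematicalPhysics.QuantumFieldTheory.Balaban1983to89.B9SectBCodedClassR (RegExtraY bg9YC)
open Literature.MathematicalPhysics.QuantumFieldTheory.Balaban1983to89.B9SectBCodedReadingsUR (KSCU KACU SectBStepU Thm34U)
open Literature.MathematicalPhysics.QuantumFieldTheory.Balaban1983to89.B9SectBCodedCarrier (pullS)
open Literature.MathematicalPhysics.QuantumFieldTheory.Balaban1983to89.B9Eq360DeltaPrimeAY (AfldY)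
open Literature.MathematicalPhysics.QuantumFieldTheory.Balaban1983to89.B9PinMembersKLevelV1 (MemberY geo9Y)
open Literature.MathematicalPhysics.QuantumFieldTheory.Balaban1983to89.B9SectBGpLettersY (decY)
open Literature.MathematicalPhysics.QuantumFieldTheory.Balaban1983to89.B9SectBGpFrameCodedYR (codingYx)
open Literature.MathematicalPhysics.QuantumFieldTheory.Balaban1983to89.B9SectBGpReadingsY (baseY)
open Literature.MathematicalPhysics.QuantumFieldTheory.Balaban1983to89.B9SectBCodedChainAnR (IsAnKY)
open Literature.MathematicalPhysics.QuantumFieldTheory.Balaban1983to89.B9SectBH1ReadWriteY (h1ReadT)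
open Literature.MathematicalPhysics.QuantumFieldTheory.Balaban1983to89.Node00 (SiteY CfgY SiteParY BondParY BondOpY GpY)
open Literature.MathematicalPhysics.QuantumFieldTheory.Balaban1983to89.Node00.OpsYULetters (kernelFamilySU)

variable {d ℓ : ℕ} {hd : 1 ≤ d + 1} {hL : Odd (ℓ + 1) ∧ 1 < ℓ + 1} {b₀ b₁ : ℝ} {Mstar : ℕ}
variable {𝔸 : Type} [NormedRing 𝔸] (P : RegExtraY d ℓ hd hL b₀ b₁ Mstar 𝔸) [NormedAlgebra ℂ 𝔸] [CompleteSpace 𝔸]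

/-! ## §1 The site-sector coded reading with the two transporter roles separated -/

section Readings

variable (G : Subgroup 𝔸ˣ) (x : MemberY d ℓ hd hL b₀ b₁ Mstar) (parA parH par : SiteParY 𝔸 x.toKIdx)
  (C37 C38 : ℝ → CfgY 𝔸 x.toKIdx → AfldY 𝔸 x.toKIdx → Prop)

/-- ★★★ **`KSCUPar` — THE SITE-SECTOR (G′) CODED READING WITH AVERAGING TRANSPORTER `parA` AND HÖLDER TRANSPORTER `parH`**: `kernelFamilySU` over the coded carrier with
the operator `G′ = GpY parA` (print's (3.21) contours inside `Q′(U)` ∕ `Δ′_a(U)`) at the decoding and the Hölder readings (3.43) ∕ (3.45) transported by `parH` (print's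
(3.40) shortest contours) at the base. [cite: Balaban1985BackgroundPropagators, Thm 3.4 p.400, (3.21) p.394, (3.40) p.397, (3.42)–(3.47) pp.397–398] -/
def KSCUPar : B9.KernelFamily (geo9Y x) (codingYx P G x C37 C38).bg :=
  kernelFamilySU x.toKIdx (codingYx P G x C37 C38).bg (baseY x.toKIdx) (decY x.toKIdx) (GpY x.toKIdx parA) parH

/-- ★ **TODAY's READING IS THE DIAGONAL INSTANCE**: `KSCU P G x par = KSCUPar P G x par par` (`rfl`). [cite: Balaban1985BackgroundPropagators, Thm 3.4 p.400, bookkeeping] -/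
theorem KSCU_eq_KSCUPar : KSCU P G x par C37 C38 = KSCUPar P G x par par C37 C38 := rfl

/-- the (3.43) member of `KSCUPar` IS the U-letter reading `h1ReadT (G′_{parA}(dec c)) (parH (base c)) (base c)` (`rfl`) — the READ∕WRITE dictionary of
`B9SectBH1ReadWriteY` applies with the Hölder transporter `parH`. [cite: Balaban1985BackgroundPropagators, (3.43) p.398, (3.40) p.397, bookkeeping] -/
theorem KSCUPar_h1_inl (c : (codingYx P G x C37 C38).bg.Cfg) (f : SiteY x.toKIdx → ℝ) (α : ℝ) (z : SiteY x.toKIdx → ℝ) :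
    (KSCUPar P G x parA parH C37 C38).h1 c (.inl f) α (.inl z) =
      h1ReadT x.toKIdx (GpY x.toKIdx parA (decY x.toKIdx c)) (parH (baseY x.toKIdx c)) (baseY x.toKIdx c) f α z := rfl

end Readings

/-! ## §2 The row-13 targets with the two transporters -/

section Targets

variable {J : Type} (f : J → MemberY d ℓ hd hL b₀ b₁ Mstar) (dC : ℕ) (c35 : ℝ) (G : Subgroup 𝔸ˣ) {ι : Type} [Fintype ι] (b : Module.Basis ι ℝ 𝔸)
  (parA parH par : ∀ j : J, SiteParY 𝔸 (f j).toKIdx) (OA : ∀ j : J, BondOpY 𝔸 (f j).toKIdx) (parB : ∀ j : J, BondParY 𝔸 (f j).toKIdx)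
  (C37 C38 : ∀ j : J, ℝ → CfgY 𝔸 (f j).toKIdx → AfldY 𝔸 (f j).toKIdx → Prop)
  (Cinv : ∀ j : J, B9.SiteKernel (geo9Y (f j)) (bg9YC 𝔸 G P (f j)))

/-- ★★★ **THE SECT.-B STEP OF RECORD WITH THE TWO TRANSPORTERS**: `B9.SectBStepPrinted` over the coded carriers for `KSCUPar … (parA j) (parH j)` (G′), `KACU` (G), the
(3.48) kernel `Cinv` read along the decoding, and the coded analyticity predicate at the AVERAGING family `IsAnKY … (parA j)`.  A `Prop`; nothing asserted.
[cite: Balaban1985BackgroundPropagators, Thm 3.4 p.400, Sect. B pp.400–407, (3.21) p.394, (3.40) p.397] -/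
def SectBStepUPar : Prop :=
  B9.SectBStepPrinted dC c35 (fun j => geo9Y (f j)) (fun j => (codingYx P G (f j) (C37 j) (C38 j)).bg)
    (fun j => KSCUPar P G (f j) (parA j) (parH j) (C37 j) (C38 j)) (fun j => KACU P G (f j) (OA j) (parB j) (C37 j) (C38 j))
    (fun j => pullS (codingYx P G (f j) (C37 j) (C38 j)) (Cinv j)) (fun j => IsAnKY P G (f j) (parA j) b (C37 j) (C38 j))

/-- ★★ **THEOREM 3.4 OF RECORD WITH THE TWO TRANSPORTERS**: `B9.Thm34Printed` over the coded carriers for `(KSCUPar parA parH, KACU, IsAnKY parA)`.  A `Prop`; nothing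
asserted. [cite: Balaban1985BackgroundPropagators, Thm 3.4 p.400, (3.21) p.394, (3.40) p.397] -/
def Thm34UPar : Prop :=
  B9.Thm34Printed c35 (fun j => geo9Y (f j)) (fun j => (codingYx P G (f j) (C37 j) (C38 j)).bg)
    (fun j => KSCUPar P G (f j) (parA j) (parH j) (C37 j) (C38 j)) (fun j => KACU P G (f j) (OA j) (parB j) (C37 j) (C38 j))
    (fun j => IsAnKY P G (f j) (parA j) b (C37 j) (C38 j))

/-- ★ today's `SectBStepU … par …` IS the diagonal instance `SectBStepUPar … par par …` (`Iff.rfl`). [cite: Balaban1985BackgroundPropagators, Thm 3.4 p.400, bookkeeping] -/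
theorem sectBStepU_iff_par :
    SectBStepU P f dC c35 G b par OA parB C37 C38 Cinv ↔ SectBStepUPar P f dC c35 G b par par OA parB C37 C38 Cinv := Iff.rfl

/-- ★ today's `Thm34U … par …` IS the diagonal instance `Thm34UPar … par par …` (`Iff.rfl`). [cite: Balaban1985BackgroundPropagators, Thm 3.4 p.400, bookkeeping] -/
theorem thm34U_iff_par : Thm34U P f c35 G b par OA parB C37 C38 ↔ Thm34UPar P f c35 G b par par OA parB C37 C38 := Iff.rfl

end Targets

end Literature.MathematicalPhysics.QuantumFieldTheory.Balaban1983to89.B9SectBCodedReadingsUParH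

end
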